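import Summits.BirchSwinnertonDyer.Rank1Residual.Additive.X4SharpThreeKimDefectParity
import Summits.BirchSwinnertonDyer.Rank1Residual.X4.KimDefectParityEndState
import Summits.BirchSwinnertonDyer.Rank1Residual.Additive.X4SharpThreeKimConjectureOptimalIntegral
import HarnessLib

/-!
# The N11 END STATE, PARITY FORM: at `p = 3` on tower rows the `3`-part of BSD in analytic rank 0 IS
# "`ord₃ #Ш_an` even AND Kim's Conjecture 1.10 WITHIN ONE", CONDITIONAL on the announced Kim 2025
# clause (cell `b2b-bsdres`, seat additive-p4 gen 19, line V38; CLASS-CLOSURE §3.1 N11, E1 sharpened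
# by Cassels–Tate; the `p = 3` twin of `X4/KimDefectParityEndState.lean`)

HONEST FRAMING (cell `b2b-bsdres`, run/shared/lean/b2b/bsd-rank1-residual/, verbatim in every
file): the goal of the cell is to DELETE the COMBINATION-SHAPED residual classes of the
Birch–Swinnerton-Dyer formula for ALL analytic-rank `≤ 1` elliptic curves over `ℚ` — "full BSD
formula for every rank `≤ 1` curve in class `C`" assembled STRICTLY from published theorems — so
that the rank-`≤ 1` remainder becomes exactly the CONSTRUCTION-SHAPED classes, which are TYPED
(missing-input `Prop`s), NOT attempted. This is not "finishing BSD". Sub-cell additive-p4 (X3♯/X4♯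
direct): research route on the CONSTRUCTION-SHAPED class X4; the label X4 and the marks of
RESIDUAL-MAP §I N10/N11 are UNCHANGED; nothing is booked. Theorems only (no definition, no named
fact minted). EVERY theorem below is CONDITIONAL on the ANNOUNCED statement
`Kim2025.thm11_kimShaLength_of_integralPeriod_OPEN` (arXiv:2505.09121 Thm. 1.1, PREPRINT, flag
`Kim2025-preprint`; hypothesis `hK25s`) — an announced preprint enters ONLY as an explicitly labelled
OPEN hypothesis, never as a theorem. Other inputs: Cassels–Tate `hCT`, Cassels' isogeny invariance
`hCassels` (§2), GZK `hGZK`, modularity `hmod` — published named facts as hypotheses.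

## What this file proves

* §1 per pair, `p ≥ 3`, `ρ̄_{E,p^n}` onto ∀ `n`, analytic rank `0`, any datum with the period transfer:
  `missingPPartAt_iff_even_and_kimDefect_within_one_of_kim2025_OPEN_of_casselsTate` —
  **`Typed.MissingPPartAt W p ⟺ ord_p #Ш_an EVEN ∧ |∂^{(∞)}(δ̃_{D.f}) − ord_p ∏_v c_v| ≤ 1`**; on
  `p ∤ #Ш_an` rows `⟺ ord_p ∏_v c_v ≤ ∂^{(∞)} + 1`
  (`missingPPartAt_iff_tamagawa_le_kimDefect_add_one_of_shaAn_unit_of_kim2025_OPEN`).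
* §2 `n11_rankZero_three_iff_kimDefectWithinOne_optimal_of_kim2025_OPEN` — gen 18's N11 END STATE
  over optimal data (`n11_rankZero_three_iff_kimTamagawaDefect_optimal_of_kim2025_OPEN'`) with clause
  (i) "Conjecture 1.10 at `3` on every optimal conductor-level datum with `3 ∤ c` of a tower curve"
  REPLACED by "`ord₃ #Ш_an` even and Conjecture 1.10 WITHIN ONE there"; clauses (ii) MANIN♭(3)
  proper and (iii) EXOTIC unchanged. The irreducible residue of N11 modulo the preprint is thereby
  HALF of the `≥` direction of Conjecture 1.10 (every other value of `∂^{(∞)}` excluded by parity).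
  N11's mark is UNCHANGED; nothing booked.

References: C.-H. Kim, arXiv:2505.09121 (PREPRINT) Thm. 1.1 [Kim2025RefinedTNC]; C.-H. Kim, Amer. J.
Math. 148 (2026) = arXiv:2203.12159v4 §1.5.1, Conj. 1.10 [Kim2022StructureSelmer]; Cassels 1962 /
Silverman *AEC* Thm. X.4.14 [SilvermanAEC2009]; Cassels 1965 [Cassels1965ArithmeticVIII]; Miller 2011
Def. 1.1 [Miller2011LMS]; siblings `Additive/X4SharpThreeKimDefectParity.lean`,
`X4/KimDefectParity{,EndState}.lean` (gen 19), `Additive/X4SharpThreeKimConjectureOptimal{,Integral}.lean`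
(gen 18).
-/

noncomputable section

open scoped Classical MatrixGroups ModularForm

open Complex CongruenceSubgroup WeierstrassCurve Literature.NumberTheory.EllipticCurves
  Literature.NumberTheory.EllipticCurves.ModularForms
  Literature.NumberTheory.EllipticCurves.Rank1Residual
  Literature.NumberTheory.EllipticCurves.Rank1Residual.Typed

namespace Summit.BirchSwinnertonDyer.Rank1Residual.Additive

section PerPair

variable (W : WeierstrassCurve ℚ) [W.IsElliptic] [W.IsGloballyMinimal] (p : ℕ) [Fact p.Prime]

/-! ### §1 Per pair at `p ≥ 3` on tower rows, CONDITIONAL on the announced clause -/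

/-- **`Typed.MissingPPartAt W p ⟺ ord_p #Ш_an EVEN ∧ Conjecture 1.10 WITHIN ONE at the pair`, `p ≥ 3`,
tower row, CONDITIONAL on the preprint** (`hK25s`, flag `Kim2025-preprint`): analytic rank `0`
(modularity), GZK, `ρ̄_{E,p^n}` onto ∀ `n`, ANY datum `D` with the period transfer, Cassels (`hCT`).
Right-hand side: `#Ш_an = q'`, `ord_p q'` even, `∂^{(∞)}(δ̃_{D.f}) = d`, `ord_p ∏_v c_v ≤ d + 1`,
`d ≤ ord_p ∏_v c_v + 1`. (`→`: gen 17's V31 iff gives `d = ord_p ∏c`; `←`: the sibling's parity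
law.) [claim: Kim2025RefinedTNC, status: under-review]
[cite: Kim2025RefinedTNC, Thm. 1.1 ("BSD") (ANNOUNCED, OPEN binder)] [cite: SilvermanAEC2009, Thm. X.4.14]
[cite: Kim2022StructureSelmer, Conj. 1.10 (PDF p. 8)] [cite: Miller2011LMS, Def. 1.1] -/
theorem missingPPartAt_iff_even_and_kimDefect_within_one_of_kim2025_OPEN_of_casselsTate
    (hK25s : Kim2025.thm11_kimShaLength_of_integralPeriod_OPEN)
    (hCT : exists_casselsTate_pairing (K := ℚ))
    (hGZK : rank_eq_analyticRank_of_analyticRank_le_one) (hmod : hasEntireLFunction_rat)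
    (hp3 : 3 ≤ p) (hr : W.analyticRank = 0) (htower : ∀ n : ℕ, W.HasSurjectiveModNGaloisRep (p ^ n : ℕ))
    {N : ℕ} [NeZero N] (D : ModularParametrizationData W N)
    (hper : ∃ u : ℚ, ‖(u : ℚ_[p])‖ = 1 ∧ W.realPeriodRat = u * plusPeriod D.f) :
    MissingPPartAt W p ↔
      ∃ (q' : ℚ) (d : ℕ), shaAn W = (q' : ℂ) ∧ Even (padicValRat p q') ∧
        kuriharaPartialInfty W p D.f = d ∧
        padicValNat p W.tamagawaProduct ≤ d + 1 ∧ d ≤ padicValNat p W.tamagawaProduct + 1 := by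
  have hp2 : p ≠ 2 := by omega
  have hint := forall_padicValRat_ratPlusSymbol_nonneg_of_towerSurj hp2 D.isNewformOf htower
  constructor
  · intro h
    obtain ⟨q', hq', hev⟩ := X4.exists_even_padicValRat_shaAn_of_missingPPartAt_of_casselsTate W p hCT
      hGZK (by rw [hr]; exact zero_le_one) h
    have hK : X4.KimTamagawaDefectAt W p D.f :=
      (missingPPartAt_iff_kimTamagawaDefectAt_of_kim2025_OPEN W p hK25s hGZK hmod hp3 hr htower D hper
        hint).mp h
    rw [X4.KimTamagawaDefectAt] at hK
    exact ⟨q', padicValNat p W.tamagawaProduct, hq', hev, hK, by omega, by omega⟩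
  · rintro ⟨q', d, hq', hev, hd, hge, hle⟩
    refine missingPPartAt_of_kimDefect_within_one_of_even_of_kim2025_OPEN W p hK25s hCT hGZK hmod hp3 hr
      htower D hper hq' hev ?_ ?_
    · rw [hd]; exact_mod_cast hge
    · rw [hd]; exact_mod_cast hle

/-- **On a `p ∤ #Ш_an` tower row, `p ≥ 3`, CONDITIONAL on the preprint:
`Typed.MissingPPartAt W p ⟺ ord_p ∏_v c_v ≤ ∂^{(∞)}(δ̃_{D.f}) + 1`** — the N11 TAM-DEFECT₂♭ rows'
missing input, one notch weaker than the `≥` half of Conjecture 1.10.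
[claim: Kim2025RefinedTNC, status: under-review]
[cite: Kim2025RefinedTNC, Thm. 1.1 ("BSD") (ANNOUNCED, OPEN binder)] [cite: SilvermanAEC2009, Thm. X.4.14]
[cite: Miller2011LMS, Def. 1.1] -/
theorem missingPPartAt_iff_tamagawa_le_kimDefect_add_one_of_shaAn_unit_of_kim2025_OPEN
    (hK25s : Kim2025.thm11_kimShaLength_of_integralPeriod_OPEN)
    (hCT : exists_casselsTate_pairing (K := ℚ))
    (hGZK : rank_eq_analyticRank_of_analyticRank_le_one) (hmod : hasEntireLFunction_rat)
    (hp3 : 3 ≤ p) (hr : W.analyticRank = 0) (htower : ∀ n : ℕ, W.HasSurjectiveModNGaloisRep (p ^ n : ℕ))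
    {N : ℕ} [NeZero N] (D : ModularParametrizationData W N)
    (hper : ∃ u : ℚ, ‖(u : ℚ_[p])‖ = 1 ∧ W.realPeriodRat = u * plusPeriod D.f)
    {q' : ℚ} (hq' : shaAn W = (q' : ℂ)) (hv : padicValRat p q' = 0) :
    MissingPPartAt W p ↔
      (padicValNat p W.tamagawaProduct : ℕ∞) ≤ kuriharaPartialInfty W p D.f + 1 := by
  have hp2 : p ≠ 2 := by omega
  have hint := forall_padicValRat_ratPlusSymbol_nonneg_of_towerSurj hp2 D.isNewformOf htower
  have hev : Even (padicValRat p q') := by rw [hv]; exact ⟨0, rfl⟩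
  constructor
  · intro h
    have hK : X4.KimTamagawaDefectAt W p D.f :=
      (missingPPartAt_iff_kimTamagawaDefectAt_of_kim2025_OPEN W p hK25s hGZK hmod hp3 hr htower D hper
        hint).mp h
    rw [X4.KimTamagawaDefectAt] at hK
    rw [hK]
    exact le_self_add
  · intro hge
    have hup := missingUpperBoundAt_of_tamagawa_le_kimDefect_add_one_of_even_of_kim2025_OPEN W p hK25s
      hCT hGZK hmod hp3 hr htower D hper hq' hev hge
    have hlow : MissingLowerBoundAt W p := ⟨q', hq', by rw [hv]; exact_mod_cast Nat.zero_le _⟩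
    exact missingPPartAt_of_lower_of_upper W p hlow hup

end PerPair

/-! ### §2 The N11 END STATE over optimal data, PARITY FORM, CONDITIONAL on the announced clause -/

section EndState

/-- **THE N11 END STATE over optimal data, PARITY FORM** (the sibling
`n11_rankZero_three_iff_kimTamagawaDefect_optimal_of_kim2025_OPEN'` with clause (i) "Conjecture 1.10
at `3` on every optimal conductor-level datum with `3 ∤ c` of a tower curve" REPLACED by "`ord₃ #Ш_an`
even and Conjecture 1.10 WITHIN ONE there"): on `hK25s` (ANNOUNCED, OPEN) + Cassels–Tate `hCT` +
Cassels' isogeny invariance `hCassels` + GZK + modularity, ∀-`MissingPPartAt` over X4 ∧ `r_an = 0` ∧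
surj(3) ⟺ (i′) ∧ (ii) MissingPPartAt on tower classes with no strong datum prime to `3` ∧ (iii) the
EXOTIC rows. Parity supplies the other half of Conjecture 1.10. N11 stays as labelled; nothing booked.
[claim: Kim2025RefinedTNC, status: under-review]
[cite: Kim2025RefinedTNC, Thm. 1.1 ("BSD") (ANNOUNCED, OPEN binder)] [cite: Kim2022StructureSelmer, Conj. 1.10 (PDF p. 8)]
[cite: SilvermanAEC2009, Thm. X.4.14] [cite: Cassels1965ArithmeticVIII] [cite: Miller2011LMS, §1 and Def. 1.1] -/
theorem n11_rankZero_three_iff_kimDefectWithinOne_optimal_of_kim2025_OPEN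
    (hK25s : Kim2025.thm11_kimShaLength_of_integralPeriod_OPEN)
    (hCT : exists_casselsTate_pairing (K := ℚ)) (hCassels : bsdRHS_eq_of_isIsogenous)
    (hGZK : rank_eq_analyticRank_of_analyticRank_le_one) (hmod : hasEntireLFunction_rat) :
    (∀ (W : WeierstrassCurve ℚ) [W.IsElliptic] [W.IsGloballyMinimal],
        W.analyticRank = 0 → ClassX4 W 3 → Surj W 3 → MissingPPartAt W 3) ↔
      (∀ (W : WeierstrassCurve ℚ) [W.IsElliptic] [W.IsGloballyMinimal],
          W.analyticRank = 0 → ClassX4 W 3 → (∀ n : ℕ, W.HasSurjectiveModNGaloisRep (3 ^ n : ℕ)) →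
          ∀ {N : ℕ} [NeZero N] (D : ModularParametrizationData W N), W.conductorNorm ℤ = N →
          (∀ z ∈ D.L.lattice, ∃ w ∈ periodLattice D.f, z = D.c * w) → ¬ (3 : ℤ) ∣ D.maninConstant →
          ∃ (q' : ℚ) (d : ℕ), shaAn W = (q' : ℂ) ∧ Even (padicValRat 3 q') ∧
            kuriharaPartialInfty W 3 D.f = d ∧
            padicValNat 3 W.tamagawaProduct ≤ d + 1 ∧ d ≤ padicValNat 3 W.tamagawaProduct + 1) ∧
      (∀ (W : WeierstrassCurve ℚ) [W.IsElliptic] [W.IsGloballyMinimal],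
          W.analyticRank = 0 → ClassX4 W 3 → (∀ n : ℕ, W.HasSurjectiveModNGaloisRep (3 ^ n : ℕ)) →
          (∀ (W₀ : WeierstrassCurve ℚ) [W₀.IsElliptic] [W₀.IsGloballyMinimal], IsIsogenous W₀ W →
            ∀ (N₀ : ℕ) [NeZero N₀] (D₀ : ModularParametrizationData W₀ N₀),
              W₀.conductorNorm ℤ ≠ N₀ ∨ (¬ ∀ z ∈ D₀.L.lattice, ∃ w ∈ periodLattice D₀.f, z = D₀.c * w) ∨
              (3 : ℤ) ∣ D₀.maninConstant) →
          MissingPPartAt W 3) ∧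
      (∀ (W : WeierstrassCurve ℚ) [W.IsElliptic] [W.IsGloballyMinimal],
          W.analyticRank = 0 → ClassX4 W 3 → Surj W 3 →
          ¬ (∀ n : ℕ, W.HasSurjectiveModNGaloisRep (3 ^ n : ℕ)) → MissingPPartAt W 3) := by
  haveI : Fact (Nat.Prime 3) := ⟨Nat.prime_three⟩
  rw [n11_rankZero_three_iff_kimTamagawaDefect_optimal_of_kim2025_OPEN' hK25s hCassels hGZK hmod]
  refine and_congr_left fun _ => ?_
  have key : ∀ (W : WeierstrassCurve ℚ) [W.IsElliptic] [W.IsGloballyMinimal],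
      W.analyticRank = 0 → (∀ n : ℕ, W.HasSurjectiveModNGaloisRep (3 ^ n : ℕ)) →
      ∀ {N : ℕ} [NeZero N] (D : ModularParametrizationData W N),
      (∀ z ∈ D.L.lattice, ∃ w ∈ periodLattice D.f, z = D.c * w) → ¬ (3 : ℤ) ∣ D.maninConstant →
      (X4.KimTamagawaDefectAt W 3 D.f ↔
        ∃ (q' : ℚ) (d : ℕ), shaAn W = (q' : ℂ) ∧ Even (padicValRat 3 q') ∧
          kuriharaPartialInfty W 3 D.f = d ∧
          padicValNat 3 W.tamagawaProduct ≤ d + 1 ∧ d ≤ padicValNat 3 W.tamagawaProduct + 1) := by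
    intro W _ _ hr htower N _ D hopt hc
    have hper := X4.periodTransfer_of_optimal 3 D hopt hc
    have hint := forall_padicValRat_ratPlusSymbol_nonneg_of_towerSurj (by norm_num) D.isNewformOf
      htower
    rw [← missingPPartAt_iff_kimTamagawaDefectAt_of_kim2025_OPEN W 3 hK25s hGZK hmod le_rfl hr htower D
      hper hint]
    exact missingPPartAt_iff_even_and_kimDefect_within_one_of_kim2025_OPEN_of_casselsTate W 3 hK25s hCT
      hGZK hmod le_rfl hr htower D hper
  constructor
  · intro hconj W _ _ hr hX htower N _ D hN hopt hc
    exact (key W hr htower D hopt hc).mp (hconj W hr hX htower D hN hopt hc)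
  · intro hwithin W _ _ hr hX htower N _ D hN hopt hc
    exact (key W hr htower D hopt hc).mpr (hwithin W hr hX htower D hN hopt hc)

end EndState

end Summit.BirchSwinnertonDyer.Rank1Residual.Additive

end
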